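import Literature.Analysis.FluidPDE.TurbWave0

/-!
# Route EulerLimit (AnomalousDissipation) — Cesàro means of continuous periodic functions

Settles stmt-AnomalousDissipation-0514 (support lemma #5 of route `AnomalousDissipation/EulerLimit`,
also wanted by route CoherentStates): for a continuous `τ`-periodic `g : ℝ → ℝ`, `τ > 0`, the
running time means `Literature.Turb.timeMean g T = T⁻¹ ∫₀ᵀ g` converge to the period mean
`τ⁻¹ ∫₀^τ g` as `T → ∞`, hence `Literature.Turb.longTimeAvgSup g` (the `limsup` of the running means)
equals the period mean. Pure real analysis: Mathlib's sandwich
`Function.Periodic.sInf_add_zsmul_le_integral_of_pos` / `integral_le_sSup_add_zsmul_of_pos`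
(`X₁ + ⌊T/τ⌋ • ∫₀^τ g ≤ ∫₀ᵀ g ≤ X₂ + ⌊T/τ⌋ • ∫₀^τ g`) divided by `T`, with `T⁻¹⌊T/τ⌋ → τ⁻¹`.
Folklore (Doering–Foias, JFM 467 (2002) §2, long-time averages).
-/

open Filter Topology Set MeasureTheory

namespace Literature.Turb

/-- Settles stmt-AnomalousDissipation-0514: Cesàro means of a continuous `τ`-periodic real
function converge to its period mean, and `longTimeAvgSup` equals that mean.
Doering–Foias 2002 §2 (long-time averages); standard real analysis. [folklore] -/
theorem tendsto_timeMean_of_periodic : ∀ (g : ℝ → ℝ) (τ : ℝ), 0 < τ → Continuous g → Function.Periodic g τ → Filter.Tendsto (Literature.Analysis.FluidPDE.timeMean g) Filter.atTop (nhds (τ⁻¹ * ∫ t in (0 : ℝ)..τ, g t)) ∧ Literature.Analysis.FluidPDE.longTimeAvgSup g = τ⁻¹ * ∫ t in (0 : ℝ)..τ, g t := by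
  intro g τ hτ hg hper
  set I := ∫ t in (0:ℝ)..τ, g t with hI
  have hint : IntervalIntegrable g volume 0 τ := hg.intervalIntegrable 0 τ
  set X₁ := sInf ((fun t => ∫ x in (0:ℝ)..t, g x) '' Icc 0 τ) with hX₁
  set X₂ := sSup ((fun t => ∫ x in (0:ℝ)..t, g x) '' Icc 0 τ) with hX₂
  have hlo : ∀ T, X₁ + ⌊T/τ⌋ • I ≤ ∫ x in (0:ℝ)..T, g x := fun T =>
    hper.sInf_add_zsmul_le_integral_of_pos hint hτ T
  have hhi : ∀ T, (∫ x in (0:ℝ)..T, g x) ≤ X₂ + ⌊T/τ⌋ • I := fun T =>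
    hper.integral_le_sSup_add_zsmul_of_pos hint hτ T
  have hfloor : Tendsto (fun T : ℝ => T⁻¹ * (⌊T/τ⌋ : ℝ)) atTop (𝓝 τ⁻¹) := by
    have h1 : Tendsto (fun T : ℝ => T⁻¹ * (T/τ)) atTop (𝓝 τ⁻¹) := by
      apply tendsto_const_nhds.congr'
      filter_upwards [eventually_gt_atTop 0] with T hT
      field_simp
    have h2 : Tendsto (fun T : ℝ => T⁻¹ * (T/τ - 1)) atTop (𝓝 τ⁻¹) := by
      have h3 : Tendsto (fun T : ℝ => T⁻¹ * (T/τ) - T⁻¹) atTop (𝓝 (τ⁻¹ - 0)) :=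
        h1.sub tendsto_inv_atTop_zero
      rw [sub_zero] at h3
      apply h3.congr'
      filter_upwards with T
      ring
    refine tendsto_of_tendsto_of_tendsto_of_le_of_le' h2 h1 ?_ ?_
    · filter_upwards [eventually_gt_atTop 0] with T hT
      apply mul_le_mul_of_nonneg_left _ (inv_nonneg.mpr hT.le)
      linarith [Int.sub_one_lt_floor (T/τ)]
    · filter_upwards [eventually_gt_atTop 0] with T hT
      exact mul_le_mul_of_nonneg_left (Int.floor_le _) (inv_nonneg.mpr hT.le)
  have hconst : ∀ c : ℝ, Tendsto (fun T : ℝ => T⁻¹ * c) atTop (𝓝 0) := fun c => by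
    simpa using tendsto_inv_atTop_zero.mul_const c
  have hbound : ∀ X : ℝ, Tendsto (fun T : ℝ => T⁻¹ * (X + ⌊T/τ⌋ • I)) atTop (𝓝 (τ⁻¹ * I)) := by
    intro X
    have h4 : Tendsto (fun T : ℝ => T⁻¹ * X + (T⁻¹ * (⌊T/τ⌋ : ℝ)) * I) atTop (𝓝 (0 + τ⁻¹ * I)) :=
      (hconst X).add (hfloor.mul_const I)
    rw [zero_add] at h4
    apply h4.congr'
    filter_upwards with T
    rw [zsmul_eq_mul]
    ring
  have hT : Tendsto (Literature.Analysis.FluidPDE.timeMean g) atTop (𝓝 (τ⁻¹ * I)) := by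
    refine tendsto_of_tendsto_of_tendsto_of_le_of_le' (hbound X₁) (hbound X₂) ?_ ?_
    · filter_upwards [eventually_gt_atTop 0] with T hT
      show T⁻¹ * (X₁ + ⌊T/τ⌋ • I) ≤ T⁻¹ * ∫ t in (0:ℝ)..T, g t
      exact mul_le_mul_of_nonneg_left (hlo T) (inv_nonneg.mpr hT.le)
    · filter_upwards [eventually_gt_atTop 0] with T hT
      show T⁻¹ * (∫ t in (0:ℝ)..T, g t) ≤ T⁻¹ * (X₂ + ⌊T/τ⌋ • I)
      exact mul_le_mul_of_nonneg_left (hhi T) (inv_nonneg.mpr hT.le)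
  exact ⟨hT, hT.limsup_eq⟩

end Literature.Turb
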